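import Mathlib
import HarnessLib

/-!
# Route `GenusKolyvaginAtTwo`, crux L_T `PowDvdShaCardAtTwoRT` (stmt-BirchSwinnertonDyer-23242), LINE 18 stub 3a⁗ —
# I4′, the STEP-B BRIDGE: targets from a character — for a (possibly DEPENDENT) family of `τ`-eigenclasses, the Frobenius values
# realised from one hom `χ : 𝒞 → ℤ/2^M` have exactly the orders of `χ` on the family

LEAD seat `bsd-line-gk2-p1` g15 (cell `bsd-f1-sign2`), `--supports stmt-BirchSwinnertonDyer-23242` (helper). Mathlib-only; THEOREMS ONLY.
BSD is not proved by this file; neither is the crux or the stub.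

WHY (memo `Cruxes/PowDvdShaCardAtTwoRT/Lines/plus-descent-lead-g15-v2.md` §2, binder `hceb`). McCallum's Step B at `p = 2` in the tree
(`GenusExact.exists_orders_of_signStable`, `…EquivariantChebotarevAtTwoSignedStepB`, gk2-p2 g9) chooses, for an INDEPENDENT signed-stable
family `c_i` (`σ_* c_i = s_i c_i`), free TARGETS `x_i ∈ E[2^M] = R_M P` with `s_i τ x_i + x_i` of prescribed order, and realises them as
`([c_i, ρ])_i` by independence. The two-prime swap prescribes on the triple `{c_L(n/ℓ₀), c_L(n), c*}`, which may be DEPENDENT; then the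
targets must come from ONE homomorphism on the span `𝒞`. `…RTKleinDetect` (p691590) produces the character: `χ : 𝒞 →+ ℤ/2^M` with
`χ(c_i)` of the prescribed orders (iff the Klein residue fails). THIS FILE is the bridge from `χ` to Step-B targets:
* `exists_addMonoidHom_apply_eq_val_zsmul` — the targets `x := (χ ·).val • P` form a HOMOMORPHISM `𝒞 →+ T` (so they are values `[·, ρ]`
  of a single Galois element once the subgroup form of McCallum's (2) realises homs on `𝒞`);
* `addOrderOf_sign_tau_add_eq` — `addOrderOf (s τP + P) = 2^M` for any integer `s` (the `P`-coefficient of `k(sτP+P)` is `k`);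
* `addOrderOf_val_zsmul_eq_addOrderOf` — `addOrderOf ((z.val) • Q) = addOrderOf z` for `Q` of order `2^M`, `z : ℤ/2^M`;
* **`stepB_orders_of_character`** — for `x_i := (χ c_i).val • P`: `s_i τ x_i + x_i = (χ c_i).val • (s_i τP + P)` has order EXACTLY
  `addOrderOf (χ c_i)`; threshold form `2^{N_i}•(…) = 0 ∧ (N_i ≠ 0 → 2^{N_i−1}•(…) ≠ 0)` — the conclusion shape of `exists_orders_of_signStable`.

References: [McCallumLMS1991] §3 (2), Prop. 3.1, Cor. 3.2; [GrossLMS1991] §9.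
-/

set_option autoImplicit false
-- `Summit.<P>.<Sub>` repeats `BirchSwinnertonDyer` by the tree's layout convention (D-0017)
set_option linter.dupNamespace false

namespace Summit.BirchSwinnertonDyer.BirchSwinnertonDyer.Theorems.GenusExact.PlusDescent

section Bridge

variable {G T : Type*} [AddCommGroup G] [AddCommGroup T] {M : ℕ}

/-- **Targets from a character form a homomorphism.** For `P` with `2^M P = 0` and `χ : G →+ ℤ/2^M` there is `φ : G →+ T` with
`φ g = (χ g).val • P` (namely `ZMod.lift` of `k ↦ k • P` composed with `χ`). [folklore] -/
theorem exists_addMonoidHom_apply_eq_val_zsmul {P : T} (htor : (2 ^ M : ℤ) • P = 0) (χ : G →+ ZMod (2 ^ M)) :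
    ∃ φ : G →+ T, ∀ g, φ g = ((χ g).val : ℤ) • P := by
  haveI : NeZero (2 ^ M) := ⟨pow_ne_zero _ two_ne_zero⟩
  let f : {f : ℤ →+ T // f (2 ^ M : ℕ) = 0} :=
    ⟨zmultiplesHom T P, by rw [zmultiplesHom_apply]; exact_mod_cast htor⟩
  refine ⟨(ZMod.lift (2 ^ M) f).comp χ, fun g ↦ ?_⟩
  rw [AddMonoidHom.comp_apply]
  have hcast : χ g = (((χ g).val : ℤ) : ZMod (2 ^ M)) := by
    rw [Int.cast_natCast, ZMod.natCast_zmod_val]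
  rw [hcast, ZMod.lift_coe]
  change (zmultiplesHom T P) ((χ g).val : ℤ) = _
  rw [zmultiplesHom_apply, ← hcast]

/-- **The vector `s τP + P` has full order `2^M`** (any integer `s`; `s = ±1` in Step B) when `(P, τP)` is free over `ℤ/2^M`
(`E[2^M] = R_M P`, route item Q1): the `P`-coefficient of `k(sτP + P)` is `k`.
[cite: McCallumLMS1991, §3 Prop. 3.1 (proof: the ⟨τ⟩-basis)] -/
theorem addOrderOf_sign_tau_add_eq (τ : T →+ T) {P : T} (hPM : (2 : ℤ) ^ M • P = 0)
    (hfree : ∀ a b : ℤ, a • P + b • τ P = 0 → (2 : ℤ) ^ M ∣ a ∧ (2 : ℤ) ^ M ∣ b) (s : ℤ) :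
    addOrderOf (s • τ P + P) = 2 ^ M := by
  have hτPM : (2 : ℤ) ^ M • τ P = 0 := by rw [← map_zsmul, hPM, map_zero]
  apply Nat.dvd_antisymm
  · rw [addOrderOf_dvd_iff_nsmul_eq_zero, ← natCast_zsmul, Nat.cast_pow, Nat.cast_ofNat, zsmul_add, smul_comm, hτPM, smul_zero,
      hPM, add_zero]
  · -- `k • (s τP + P) = 0` forces `2^M ∣ k`
    have h0 : ((addOrderOf (s • τ P + P) : ℕ) : ℤ) • P + (((addOrderOf (s • τ P + P) : ℕ) : ℤ) * s) • τ P = 0 := by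
      have h := addOrderOf_nsmul_eq_zero (s • τ P + P)
      rw [← natCast_zsmul, zsmul_add, smul_smul] at h
      rwa [add_comm] at h
    obtain ⟨h, -⟩ := hfree _ _ h0
    exact_mod_cast Int.natCast_dvd_natCast.mp (by exact_mod_cast h)

/-- **`addOrderOf (z.val • Q) = addOrderOf z`** for `Q` of additive order `2^M` and `z : ℤ/2^M`. [folklore] -/
theorem addOrderOf_val_zsmul_eq_addOrderOf {Q : T} (hQ : addOrderOf Q = 2 ^ M) (z : ZMod (2 ^ M)) :
    addOrderOf ((z.val : ℤ) • Q) = addOrderOf z := by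
  haveI : NeZero (2 ^ M) := ⟨pow_ne_zero _ two_ne_zero⟩
  have hfin : IsOfFinAddOrder Q := addOrderOf_pos_iff.mp (by rw [hQ]; positivity)
  rw [natCast_zsmul, hfin.addOrderOf_nsmul, hQ]
  conv_rhs => rw [← ZMod.natCast_zmod_val z, ZMod.addOrderOf_coe _ (NeZero.ne (2 ^ M))]

/-- **STEP-B TARGETS FROM A CHARACTER (I4′ bridge).** `τ : T →+ T`, `P ∈ T` with `2^M P = 0` and `(P, τP)` free over `ℤ/2^M`; a family
`g_i` in a group `G` with signs `s_i` (any integers; `±1` in Step B) and a character `χ : G →+ ℤ/2^M` with `addOrderOf (χ g_i) = 2^{N_i}`. Then the targets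
`x_i := (χ g_i).val • P` satisfy: **`s_i • τ x_i + x_i` has order exactly `2^{N_i}`**, in the threshold form of `exists_orders_of_signStable`.
For a dependent eigen triple this replaces the free choice of targets: `χ` comes from `exists_addMonoidHom_fullOrder_pair_and_ne_zero_iff`
(`…RTKleinDetect`), and `x = φ ∘ g` for the homomorphism `φ` of `exists_addMonoidHom_apply_eq_val_zsmul`.
[cite: McCallumLMS1991, §3 Prop. 3.1, Cor. 3.2] [cite: GrossLMS1991, §9] -/
theorem stepB_orders_of_character (τ : T →+ T) {P : T} (hPM : (2 : ℤ) ^ M • P = 0)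
    (hfree : ∀ a b : ℤ, a • P + b • τ P = 0 → (2 : ℤ) ^ M ∣ a ∧ (2 : ℤ) ^ M ∣ b)
    {ι : Type*} (g : ι → G) (sgn : ι → ℤ)
    (χ : G →+ ZMod (2 ^ M)) (N : ι → ℕ) (hN : ∀ i, addOrderOf (χ (g i)) = 2 ^ N i) :
    ∀ i, addOrderOf (sgn i • τ (((χ (g i)).val : ℤ) • P) + ((χ (g i)).val : ℤ) • P) = 2 ^ N i ∧
      (2 : ℤ) ^ N i • (sgn i • τ (((χ (g i)).val : ℤ) • P) + ((χ (g i)).val : ℤ) • P) = 0 ∧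
      (N i ≠ 0 → (2 : ℤ) ^ (N i - 1) • (sgn i • τ (((χ (g i)).val : ℤ) • P) + ((χ (g i)).val : ℤ) • P) ≠ 0) := by
  intro i
  -- `s τ(k•P) + k•P = k • (s τP + P)`
  have hval : sgn i • τ (((χ (g i)).val : ℤ) • P) + ((χ (g i)).val : ℤ) • P =
      ((χ (g i)).val : ℤ) • (sgn i • τ P + P) := by
    rw [map_zsmul, zsmul_add, smul_comm]
  have hord : addOrderOf (sgn i • τ (((χ (g i)).val : ℤ) • P) + ((χ (g i)).val : ℤ) • P) = 2 ^ N i := by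
    rw [hval, addOrderOf_val_zsmul_eq_addOrderOf (addOrderOf_sign_tau_add_eq τ hPM hfree (sgn i)), hN i]
  refine ⟨hord, ?_, ?_⟩
  · have h := addOrderOf_nsmul_eq_zero (sgn i • τ (((χ (g i)).val : ℤ) • P) + ((χ (g i)).val : ℤ) • P)
    rw [hord, ← natCast_zsmul] at h
    exact_mod_cast h
  · intro hN0 h
    have hdvd := addOrderOf_dvd_of_nsmul_eq_zero (x := sgn i • τ (((χ (g i)).val : ℤ) • P) + ((χ (g i)).val : ℤ) • P)
      (n := 2 ^ (N i - 1)) (by rw [← natCast_zsmul]; exact_mod_cast h)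
    rw [hord, Nat.pow_dvd_pow_iff_le_right one_lt_two] at hdvd
    omega

end Bridge

end Summit.BirchSwinnertonDyer.BirchSwinnertonDyer.Theorems.GenusExact.PlusDescent
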